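import Literature.Barriers.Schanuel.NesterenkoModularScopeAnalytic
import Literature.Barriers.Schanuel.NesterenkoModularScopeMeasurePolys
import Literature.NumberTheory.Transcendental.NesterenkoEliminationCor410Proofs
import Literature.NumberTheory.Transcendental.NesterenkoEliminationProp47ValuesProofs
import Literature.NumberTheory.Transcendental.NesterenkoUResultantValue
import HarnessLib

/-!
# Barrier (Schanuel) `NesterenkoModularScope`: the transfer principle along `ω̄(z) = (1, z, P, Q, R)`, `z → 0` — part 1, asymptotics

Proofs-and-definitions sibling of `NesterenkoModularScope.lean`; nothing is asserted as a fact.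

Nesterenko's multiplicity estimate (LNM 1752 Ch. 10) runs the "algebraic fundamentals" of Ch. 3 §4
over the function field `K = ℂ(z)` with the `z`-adic absolute value. For the DIAGONAL estimate that
the proof of Ch. 3 Theorem 1.1 actually consumes (`NesterenkoModularScopeDiagonal.lean`) the variable
`z` may instead be projectivised as a fifth coordinate over the constant field `ℚ`, and every
`z`-adic inequality between the invariants of a FIXED ideal `I ⊂ ℚ[x₀, …, x₄]` is the limit, as
`z₀ → 0`, of the archimedean inequalities of Ch. 3 §4 (proved in the tree for `K = ℚ`) at the complex
points `ω̄(z₀) = (1, z₀, P(z₀), Q(z₀), R(z₀))`: the error terms are `O(1)` in `z₀` while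
`log |g(ω̄(z₀))| ∼ (ord_{z=0} g) · log |z₀|` for every polynomial `g`. This file proves the
asymptotic statements this transfer rests on.

## References

* [NesterenkoPhilippon2001] Yu. V. Nesterenko, P. Philippon (eds.), *Introduction to Algebraic
  Independence Theory*, LNM 1752, Springer 2001, Ch. 3 §§4–5, Ch. 10 §§2–4.
-/

noncomputable section

open Complex MvPolynomial Filter Topology
open Literature.NumberTheory.Transcendental Literature.NumberTheory.Transcendental.Nesterenko

namespace Literature.Barriers.Schanuel

namespace Transfer

/-! ### Asymptotics at `0` of a convergent power series -/

/-- Tail estimate: if `∑ |a_n| (1/2)^n < ∞`, `a_n = 0` for `n < v`, and `∑ a_n z^n = f(z)` absolutely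
for `|z| < 1`, then `|f(z) − a_v z^v| ≤ M |z|^{v+1}` for `|z| ≤ 1/2`, with
`M = ∑_k |a_{k+v+1}| 2^{-k}`. [folklore] -/
theorem norm_sub_leading_le {a : ℕ → ℂ} {f : ℂ → ℂ}
    (hsum : ∀ z : ℂ, ‖z‖ < 1 →
      Summable (fun n => ‖a n * z ^ n‖) ∧ HasSum (fun n => a n * z ^ n) (f z))
    {v : ℕ} (hlt : ∀ n, n < v → a n = 0) :
    Summable (fun k => ‖a (k + (v + 1))‖ * (1 / 2 : ℝ) ^ k) ∧
    ∀ z : ℂ, ‖z‖ ≤ 1 / 2 →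
      ‖f z - a v * z ^ v‖ ≤ (∑' k, ‖a (k + (v + 1))‖ * (1 / 2 : ℝ) ^ k) * ‖z‖ ^ (v + 1) := by
  have hhalf : ‖((1 : ℂ) / 2)‖ < 1 := by norm_num
  have hn2 : ‖(1 / 2 : ℂ)‖ = 1 / 2 := by norm_num
  have hs := (hsum (1 / 2) hhalf).1
  have hs' : Summable fun k => ‖a (k + (v + 1))‖ * (1 / 2 : ℝ) ^ k := by
    have h1 : Summable fun k => ‖a (k + (v + 1)) * (1 / 2 : ℂ) ^ (k + (v + 1))‖ :=
      (summable_nat_add_iff (v + 1)).mpr hs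
    have h2 := h1.mul_right ((2 : ℝ) ^ (v + 1))
    refine h2.congr fun k => ?_
    rw [norm_mul, norm_pow, pow_add, hn2]
    have h3 : (1 / 2 : ℝ) ^ (v + 1) * 2 ^ (v + 1) = 1 := by
      rw [← mul_pow]; norm_num
    calc ‖a (k + (v + 1))‖ * ((1 / 2 : ℝ) ^ k * (1 / 2) ^ (v + 1)) * 2 ^ (v + 1)
        = ‖a (k + (v + 1))‖ * (1 / 2 : ℝ) ^ k * ((1 / 2 : ℝ) ^ (v + 1) * 2 ^ (v + 1)) := by ring
      _ = ‖a (k + (v + 1))‖ * (1 / 2 : ℝ) ^ k := by rw [h3, mul_one]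
  refine ⟨hs', fun z hz => ?_⟩
  have hz1 : ‖z‖ < 1 := hz.trans_lt (by norm_num)
  obtain ⟨hsz, hfz⟩ := hsum z hz1
  have hsz' : Summable fun n => a n * z ^ n := hsz.of_norm
  have hsplit := (hsz'.sum_add_tsum_nat_add (v + 1)).symm
  rw [hfz.tsum_eq] at hsplit
  have hfin : ∑ i ∈ Finset.range (v + 1), a i * z ^ i = a v * z ^ v := by
    rw [Finset.sum_range_succ, Finset.sum_eq_zero fun i hi => ?_, zero_add]
    rw [hlt i (Finset.mem_range.mp hi), zero_mul]
  rw [hfin] at hsplit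
  have htail_eq : f z - a v * z ^ v = z ^ (v + 1) * ∑' k, a (k + (v + 1)) * z ^ k := by
    rw [hsplit, add_sub_cancel_left, ← tsum_mul_left]
    refine tsum_congr fun k => ?_
    rw [pow_add]; ring
  rw [htail_eq, norm_mul, norm_pow, mul_comm]
  refine mul_le_mul_of_nonneg_right ?_ (by positivity)
  have hterm : ∀ k, ‖a (k + (v + 1)) * z ^ k‖ ≤ ‖a (k + (v + 1))‖ * (1 / 2 : ℝ) ^ k := fun k => by
    rw [norm_mul, norm_pow]
    exact mul_le_mul_of_nonneg_left (pow_le_pow_left₀ (norm_nonneg _) hz k) (norm_nonneg _)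
  have hsk : Summable fun k => ‖a (k + (v + 1)) * z ^ k‖ :=
    Summable.of_nonneg_of_le (fun k => norm_nonneg _) hterm hs'
  exact (norm_tsum_le_tsum_norm hsk).trans (hsk.tsum_le_tsum hterm hs')

/-- **Leading-term asymptotics.** If `∑ a_n z^n = f(z)` absolutely for `|z| < 1`, `a_n = 0` for
`n < v` and `a_v ≠ 0`, then `c |z|^v ≤ |f(z)| ≤ C |z|^v` near `z = 0` for some `c, C > 0`. [folklore] -/
theorem exists_bounds_of_hasSum {a : ℕ → ℂ} {f : ℂ → ℂ}
    (hsum : ∀ z : ℂ, ‖z‖ < 1 →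
      Summable (fun n => ‖a n * z ^ n‖) ∧ HasSum (fun n => a n * z ^ n) (f z))
    {v : ℕ} (hav : a v ≠ 0) (hlt : ∀ n, n < v → a n = 0) :
    ∃ c C : ℝ, 0 < c ∧ 0 < C ∧ ∀ᶠ z in 𝓝 (0 : ℂ), c * ‖z‖ ^ v ≤ ‖f z‖ ∧ ‖f z‖ ≤ C * ‖z‖ ^ v := by
  obtain ⟨hs', htail⟩ := norm_sub_leading_le hsum hlt
  -- an opaque upper bound `M ≥ 0` for the tail constant
  obtain ⟨M, hMle, hM0⟩ : ∃ M : ℝ, (∑' k, ‖a (k + (v + 1))‖ * (1 / 2 : ℝ) ^ k) ≤ M ∧ 0 ≤ M :=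
    ⟨_, le_rfl, tsum_nonneg fun k => by positivity⟩
  have hav0 : 0 < ‖a v‖ := norm_pos_iff.mpr hav
  obtain ⟨δ, hδpos, hδhalf, hδM⟩ : ∃ δ : ℝ, 0 < δ ∧ δ ≤ 1 / 2 ∧ M * δ ≤ ‖a v‖ / 2 := by
    refine ⟨min (1 / 2) (‖a v‖ / (2 * (M + 1))), lt_min (by norm_num) (div_pos hav0 (by positivity)),
      min_le_left _ _, ?_⟩
    calc M * min (1 / 2) (‖a v‖ / (2 * (M + 1))) ≤ M * (‖a v‖ / (2 * (M + 1))) :=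
          mul_le_mul_of_nonneg_left (min_le_right _ _) hM0
      _ ≤ (M + 1) * (‖a v‖ / (2 * (M + 1))) :=
          mul_le_mul_of_nonneg_right (by linarith) (by positivity)
      _ = ‖a v‖ / 2 := by field_simp
  refine ⟨‖a v‖ / 2, ‖a v‖ + M, half_pos hav0, by linarith, ?_⟩
  filter_upwards [Metric.ball_mem_nhds (0 : ℂ) hδpos] with z hz
  rw [Metric.mem_ball, dist_zero_right] at hz
  have hz2 : ‖z‖ ≤ 1 / 2 := hz.le.trans hδhalf
  have hzM : M * ‖z‖ ≤ ‖a v‖ / 2 := (mul_le_mul_of_nonneg_left hz.le hM0).trans hδM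
  have ht : ‖f z - a v * z ^ v‖ ≤ M * ‖z‖ ^ (v + 1) :=
    (htail z hz2).trans (mul_le_mul_of_nonneg_right hMle (by positivity))
  have hmain : ‖a v * z ^ v‖ = ‖a v‖ * ‖z‖ ^ v := by rw [norm_mul, norm_pow]
  have hzv : 0 ≤ ‖z‖ ^ v := by positivity
  constructor
  · -- lower bound
    have h1 : ‖a v * z ^ v‖ - ‖f z - a v * z ^ v‖ ≤ ‖f z‖ := by
      have := norm_sub_norm_le (a v * z ^ v) (a v * z ^ v - f z)
      rw [sub_sub_cancel, norm_sub_rev] at this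
      linarith
    have h2 : M * ‖z‖ ^ (v + 1) ≤ ‖a v‖ / 2 * ‖z‖ ^ v := by
      rw [pow_succ, ← mul_assoc, mul_comm M, mul_assoc]
      calc ‖z‖ ^ v * (M * ‖z‖) ≤ ‖z‖ ^ v * (‖a v‖ / 2) := mul_le_mul_of_nonneg_left hzM hzv
        _ = ‖a v‖ / 2 * ‖z‖ ^ v := by ring
    rw [hmain] at h1
    linarith
  · -- upper bound
    have h1 : ‖f z‖ ≤ ‖a v * z ^ v‖ + ‖f z - a v * z ^ v‖ := by
      have := norm_add_le (a v * z ^ v) (f z - a v * z ^ v)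
      rwa [add_sub_cancel] at this
    have h2 : M * ‖z‖ ^ (v + 1) ≤ M * ‖z‖ ^ v := by
      rw [pow_succ]
      refine mul_le_mul_of_nonneg_left ?_ hM0
      exact mul_le_of_le_one_right hzv (hz2.trans (by norm_num))
    rw [hmain] at h1
    linarith

/-- The same for a formal power series `F ≠ 0` of order `v`. [folklore] -/
theorem exists_bounds_of_hasSum_powerSeries {F : PowerSeries ℂ} {f : ℂ → ℂ}
    (hsum : ∀ z : ℂ, ‖z‖ < 1 →
      Summable (fun n => ‖PowerSeries.coeff n F * z ^ n‖) ∧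
      HasSum (fun n => PowerSeries.coeff n F * z ^ n) (f z))
    {v : ℕ} (hv : F.order = v) :
    ∃ c C : ℝ, 0 < c ∧ 0 < C ∧ ∀ᶠ z in 𝓝 (0 : ℂ), c * ‖z‖ ^ v ≤ ‖f z‖ ∧ ‖f z‖ ≤ C * ‖z‖ ^ v := by
  rw [PowerSeries.order_eq_nat] at hv
  exact exists_bounds_of_hasSum (a := fun n => PowerSeries.coeff n F) hsum hv.1 hv.2

/-- If the formal series vanishes, so does its sum on the unit disc. [folklore] -/
theorem eq_zero_of_hasSum_zero {F : PowerSeries ℂ} {f : ℂ → ℂ}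
    (hsum : ∀ z : ℂ, ‖z‖ < 1 →
      Summable (fun n => ‖PowerSeries.coeff n F * z ^ n‖) ∧
      HasSum (fun n => PowerSeries.coeff n F * z ^ n) (f z))
    (hF : F = 0) {z : ℂ} (hz : ‖z‖ < 1) : f z = 0 := by
  have h := (hsum z hz).2
  have h0 : HasSum (fun n : ℕ => PowerSeries.coeff n F * z ^ n) 0 := by
    have : (fun n : ℕ => PowerSeries.coeff n F * z ^ n) = fun _ => 0 := by
      funext n; simp [hF]
    rw [this]; exact hasSum_zero
  exact h.unique h0

/-- **Comparison of rates.** If `c |z|^a ≤ K |z|^b` near `0` with `c > 0`, then `b ≤ a`. [folklore] -/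
theorem le_of_eventually_pow_le {c K : ℝ} {a b : ℕ} (hc : 0 < c)
    (h : ∀ᶠ z in 𝓝 (0 : ℂ), c * ‖z‖ ^ a ≤ K * ‖z‖ ^ b) : b ≤ a := by
  by_contra hab
  have hab' : a < b := not_le.mp hab
  obtain ⟨d, hd⟩ := Nat.exists_eq_add_of_lt hab'
  -- for small `z ≠ 0`: `c ≤ K |z|^{d+1}`
  have hK : ∀ᶠ z in 𝓝 (0 : ℂ), z ≠ 0 → c ≤ K * ‖z‖ ^ (d + 1) := by
    filter_upwards [h] with z hz hz0
    have hza : 0 < ‖z‖ ^ a := pow_pos (norm_pos_iff.mpr hz0) a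
    have hz' : c * ‖z‖ ^ a ≤ K * ‖z‖ ^ (d + 1) * ‖z‖ ^ a := by
      rw [hd, show a + d + 1 = (d + 1) + a by ring, pow_add, ← mul_assoc] at hz
      exact hz
    exact le_of_mul_le_mul_right hz' hza
  obtain ⟨ε, hε, hεball⟩ := Metric.eventually_nhds_iff.mp hK
  -- evaluate at a small positive real `t`
  have heval : ∀ t : ℝ, 0 < t → t < ε → c ≤ K * t ^ (d + 1) := by
    intro t ht htε
    have hz : dist ((t : ℝ) : ℂ) 0 < ε := by
      rw [dist_zero_right, Complex.norm_real, Real.norm_eq_abs, abs_of_pos ht]; exact htε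
    have hz0 : ((t : ℝ) : ℂ) ≠ 0 := by exact_mod_cast ht.ne'
    have := hεball hz hz0
    rwa [Complex.norm_real, Real.norm_eq_abs, abs_of_pos ht] at this
  have hKpos : 0 < K := by
    have := heval (ε / 2) (half_pos hε) (half_lt_self hε)
    have hpow : 0 < (ε / 2) ^ (d + 1) := pow_pos (half_pos hε) _
    by_contra hK0
    have : K * (ε / 2) ^ (d + 1) ≤ 0 := mul_nonpos_of_nonpos_of_nonneg (not_lt.mp hK0) hpow.le
    linarith
  set t : ℝ := min (ε / 2) (min 1 (c / (2 * K))) with ht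
  have htpos : 0 < t := lt_min (half_pos hε) (lt_min one_pos (div_pos hc (by positivity)))
  have htε : t < ε := (min_le_left _ _).trans_lt (half_lt_self hε)
  have ht1 : t ≤ 1 := (min_le_right _ _).trans (min_le_left _ _)
  have htc : K * t ≤ c / 2 := by
    have : t ≤ c / (2 * K) := (min_le_right _ _).trans (min_le_right _ _)
    calc K * t ≤ K * (c / (2 * K)) := mul_le_mul_of_nonneg_left this hKpos.le
      _ = c / 2 := by field_simp
  have hpow : t ^ (d + 1) ≤ t := by
    rw [pow_succ]
    exact mul_le_of_le_one_left htpos.le (pow_le_one₀ htpos.le ht1)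
  have h1 := heval t htpos htε
  have h2 : K * t ^ (d + 1) ≤ K * t := mul_le_mul_of_nonneg_left hpow hKpos.le
  linarith

/-- Two-sided rates are unique. [folklore] -/
theorem eq_of_eventually_bounds {c C c' C' : ℝ} {a b : ℕ} {f : ℂ → ℂ} (hc : 0 < c) (hc' : 0 < c')
    (h : ∀ᶠ z in 𝓝 (0 : ℂ), c * ‖z‖ ^ a ≤ ‖f z‖ ∧ ‖f z‖ ≤ C * ‖z‖ ^ a)
    (h' : ∀ᶠ z in 𝓝 (0 : ℂ), c' * ‖z‖ ^ b ≤ ‖f z‖ ∧ ‖f z‖ ≤ C' * ‖z‖ ^ b) : a = b := by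
  refine le_antisymm ?_ ?_
  · refine le_of_eventually_pow_le (K := C) hc' ?_
    filter_upwards [h, h'] with z hz hz'
    exact hz'.1.trans hz.2
  · refine le_of_eventually_pow_le (K := C') hc ?_
    filter_upwards [h, h'] with z hz hz'
    exact hz.1.trans hz'.2


/-! ### Polynomials in the projective coordinates `x₀, …, x₄` along the curve `ω̄(z)` -/

/-- Dehomogenisation `x₀ ↦ 1`, `x_{i+1} ↦ yᵢ`: `ℂ[x₀, …, x₄] → ℂ[z, x₁, x₂, x₃]` (variable `0` of the
target is `z`). [cite: NesterenkoPhilippon2001, Ch. 10 §2 (p. 153), Ch. 3 §5 (p. 44)] -/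
def dehomog (G : MvPolynomial (Fin 5) ℂ) : MvPolynomial (Fin 4) ℂ :=
  bind₁ (Fin.cons 1 X : Fin 5 → MvPolynomial (Fin 4) ℂ) G

/-- `dehomog` is a ring homomorphism (it is `bind₁`). [folklore] -/
@[simp] theorem dehomog_mul (G H : MvPolynomial (Fin 5) ℂ) : dehomog (G * H) = dehomog G * dehomog H :=
  map_mul _ _ _

/-- `dehomog` is additive. [folklore] -/
@[simp] theorem dehomog_add (G H : MvPolynomial (Fin 5) ℂ) : dehomog (G + H) = dehomog G + dehomog H :=
  map_add _ _ _

/-- `x₀ ↦ 1`. [folklore] -/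
@[simp] theorem dehomog_X_zero : dehomog (X 0 : MvPolynomial (Fin 5) ℂ) = 1 := by
  simp [dehomog]

/-- `x_{i+1} ↦ yᵢ`. [folklore] -/
@[simp] theorem dehomog_X_succ (i : Fin 4) : dehomog (X i.succ : MvPolynomial (Fin 5) ℂ) = X i := by
  simp [dehomog]

/-- The exponent vectors of a form of degree `n` have degree `n`. [folklore] -/
theorem degree_eq_of_isHomogeneous {σ R : Type*} [CommSemiring R] {G : MvPolynomial σ R} {n : ℕ}
    (hG : G.IsHomogeneous n) {d : σ →₀ ℕ} (hd : coeff d G ≠ 0) : d.degree = n := by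
  rw [Finsupp.degree_eq_weight_one]
  exact hG hd

/-- `dehomog` on monomials: `x^d ↦ y^{tail d}` (the exponent of `x₀` is forgotten). [folklore] -/
theorem dehomog_monomial (d : Fin 5 →₀ ℕ) (c : ℂ) :
    dehomog (monomial d c) = monomial (Finsupp.tail d) c := by
  rw [dehomog, bind₁_monomial, monomial_eq, Finsupp.prod_fintype _ _ (fun i => by simp)]
  congr 1
  rw [Finset.prod_subset (Finset.subset_univ d.support)
    (fun i _ hi => by rw [Finsupp.notMem_support_iff.mp hi, pow_zero]), Fin.prod_univ_succ]
  simp [Finsupp.tail_apply]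

/-- `dehomog G = ∑_d [x^d]G · y^{tail d}`. [folklore] -/
theorem dehomog_eq_sum (G : MvPolynomial (Fin 5) ℂ) :
    dehomog G = ∑ d ∈ G.support, monomial (Finsupp.tail d) (coeff d G) := by
  conv_lhs => rw [G.as_sum]
  rw [dehomog, map_sum]
  exact Finset.sum_congr rfl fun d _ => by rw [← dehomog, dehomog_monomial]

/-- Exponent vectors of the same degree with the same tail are equal. [folklore] -/
theorem eq_of_tail_eq_of_degree_eq {d d' : Fin 5 →₀ ℕ} (ht : Finsupp.tail d = Finsupp.tail d')
    (hdeg : d.degree = d'.degree) : d = d' := by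
  have hsucc : ∀ j : Fin 4, d j.succ = d' j.succ := fun j => by
    have := congrArg (fun e => e j) ht
    simpa [Finsupp.tail_apply] using this
  have h0 : d 0 = d' 0 := by
    have e1 : d.degree = d 0 + ∑ j : Fin 4, d j.succ := by
      rw [Finsupp.degree_eq_sum, Fin.sum_univ_succ]
    have e2 : d'.degree = d' 0 + ∑ j : Fin 4, d' j.succ := by
      rw [Finsupp.degree_eq_sum, Fin.sum_univ_succ]
    have e3 : ∑ j : Fin 4, d j.succ = ∑ j : Fin 4, d' j.succ := Finset.sum_congr rfl fun j _ => hsucc j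
    omega
  ext i
  refine Fin.cases h0 (fun j => hsucc j) i

/-- **On forms of degree `n`, `dehomog` loses nothing**: `[y^{tail d}] dehomog G = [x^d] G` for
`|d| = n`. [folklore] -/
theorem coeff_tail_dehomog {G : MvPolynomial (Fin 5) ℂ} {n : ℕ} (hG : G.IsHomogeneous n)
    {d : Fin 5 →₀ ℕ} (hd : d.degree = n) : coeff (Finsupp.tail d) (dehomog G) = coeff d G := by
  classical
  rw [dehomog_eq_sum, coeff_sum]
  simp only [coeff_monomial]
  by_cases hmem : d ∈ G.support
  · rw [Finset.sum_eq_single d]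
    · rw [if_pos rfl]
    · intro d' hd' hne
      rw [if_neg]
      intro h
      have hdeg' : d'.degree = n := degree_eq_of_isHomogeneous hG (mem_support_iff.mp hd')
      exact hne (eq_of_tail_eq_of_degree_eq h (hdeg'.trans hd.symm))
    · exact fun h => absurd hmem h
  · rw [notMem_support_iff.mp hmem]
    refine Finset.sum_eq_zero fun d' hd' => ?_
    rw [if_neg]
    intro h
    have hdeg' : d'.degree = n := degree_eq_of_isHomogeneous hG (mem_support_iff.mp hd')
    exact hmem (eq_of_tail_eq_of_degree_eq h (hdeg'.trans hd.symm) ▸ hd')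

/-- Hence a non-zero FORM has non-zero dehomogenisation. [folklore] -/
theorem dehomog_ne_zero_of_isHomogeneous {G : MvPolynomial (Fin 5) ℂ} {n : ℕ} (hG : G.IsHomogeneous n)
    (h0 : G ≠ 0) : dehomog G ≠ 0 := by
  obtain ⟨d, hd⟩ := exists_coeff_ne_zero h0
  have hdeg : d.degree = n := degree_eq_of_isHomogeneous hG hd
  intro h
  have := coeff_tail_dehomog hG hdeg
  rw [h, coeff_zero] at this
  exact hd this.symm

/-- `ω̄(z) = (1, ramanujanPoint z)`. [folklore] -/
theorem nesterenkoOmega_eq_cons (z : ℂ) : nesterenkoOmega z = Fin.cons 1 (ramanujanPoint z) := by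
  funext i
  refine Fin.cases ?_ (fun j => ?_) i
  · rfl
  · rw [Fin.cons_succ, ramanujanPoint_eq_nesterenkoOmega_succ]

/-- Evaluation at `ω̄(z)` factors through dehomogenisation: `G(ω̄(z)) = (dehomog G)(z, P, Q, R)`.
[folklore] -/
theorem aeval_nesterenkoOmega (G : MvPolynomial (Fin 5) ℂ) (z : ℂ) :
    aeval (nesterenkoOmega z) G = aeval (ramanujanPoint z) (dehomog G) := by
  have h : (fun i => aeval (ramanujanPoint z) ((Fin.cons 1 X : Fin 5 → MvPolynomial (Fin 4) ℂ) i)) =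
      Fin.cons 1 (ramanujanPoint z) := by
    funext i
    refine Fin.cases ?_ (fun j => ?_) i <;> simp
  rw [dehomog, aeval_bind₁, nesterenkoOmega_eq_cons, h]

/-- The formal value `G(ω̂) ∈ ℂ⟦z⟧` of `G ∈ ℂ[x₀, …, x₄]` along the formal curve
`ω̂ = (1, z, P̂, Q̂, R̂)` (the `q`-series of `P, Q, R`). [cite: NesterenkoPhilippon2001, Ch. 10 §2] -/
def alongSeries (G : MvPolynomial (Fin 5) ℂ) : PowerSeries ℂ :=
  ramanujanComposite (dehomog G)

/-- `alongSeries` is multiplicative. [folklore] -/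
@[simp] theorem alongSeries_mul (G H : MvPolynomial (Fin 5) ℂ) :
    alongSeries (G * H) = alongSeries G * alongSeries H := by
  simp [alongSeries, ramanujanComposite]

/-- `alongSeries` is additive. [folklore] -/
@[simp] theorem alongSeries_add (G H : MvPolynomial (Fin 5) ℂ) :
    alongSeries (G + H) = alongSeries G + alongSeries H := by
  simp [alongSeries, ramanujanComposite]

/-- `alongSeries 0 = 0`. [folklore] -/
@[simp] theorem alongSeries_zero : alongSeries 0 = 0 := by
  simp [alongSeries, ramanujanComposite, dehomog]

/-- Constants go to constants. [folklore] -/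
@[simp] theorem alongSeries_C (c : ℂ) : alongSeries (C c) = PowerSeries.C c := by
  simp [alongSeries, ramanujanComposite, dehomog]

/-- `alongSeries` is `ℂ`-linear. [folklore] -/
@[simp] theorem alongSeries_smul (c : ℂ) (G : MvPolynomial (Fin 5) ℂ) :
    alongSeries (c • G) = c • alongSeries G := by
  rw [smul_eq_C_mul, alongSeries_mul, alongSeries_C, PowerSeries.smul_eq_C_mul]

/-- `x₀(ω̂) = 1`. [folklore] -/
@[simp] theorem alongSeries_X_zero : alongSeries (X 0 : MvPolynomial (Fin 5) ℂ) = 1 := by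
  simp [alongSeries, ramanujanComposite]

/-- `x₁(ω̂) = z`. [folklore] -/
@[simp] theorem alongSeries_X_one : alongSeries (X 1 : MvPolynomial (Fin 5) ℂ) = PowerSeries.X := by
  rw [alongSeries, show (1 : Fin 5) = (0 : Fin 4).succ from rfl, dehomog_X_succ, ramanujanComposite_X_zero]

/-- `alongSeries` of a finite sum. [folklore] -/
theorem alongSeries_sum {ι : Type*} (s : Finset ι) (G : ι → MvPolynomial (Fin 5) ℂ) :
    alongSeries (∑ i ∈ s, G i) = ∑ i ∈ s, alongSeries (G i) := by
  simp [alongSeries, ramanujanComposite, dehomog, map_sum]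

/-- **The formal value sums to the value**: `∑ₙ [zⁿ]G(ω̂) · zⁿ = G(ω̄(z))` absolutely for `|z| < 1`.
[cite: NesterenkoPhilippon2001, Ch. 3 §3 Lemma 3.2 (p. 35)] -/
theorem hasSum_alongSeries (G : MvPolynomial (Fin 5) ℂ) {z : ℂ} (hz : ‖z‖ < 1) :
    Summable (fun n => ‖PowerSeries.coeff n (alongSeries G) * z ^ n‖) ∧
    HasSum (fun n => PowerSeries.coeff n (alongSeries G) * z ^ n) (aeval (nesterenkoOmega z) G) := by
  rw [aeval_nesterenkoOmega]
  exact hasSum_ramanujanComposite (dehomog G) hz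

/-- The order `ord_{z=0} G(ω̂) ∈ ℕ∞` of `G ∈ ℂ[x₀, …, x₄]` along the curve. [cite: NesterenkoPhilippon2001, Ch. 10 §2] -/
def ordAlong (G : MvPolynomial (Fin 5) ℂ) : ℕ∞ :=
  (alongSeries G).order

/-- `ord (GH) = ord G + ord H` (`ℂ⟦z⟧` is a domain). [folklore] -/
theorem ordAlong_mul (G H : MvPolynomial (Fin 5) ℂ) : ordAlong (G * H) = ordAlong G + ordAlong H := by
  rw [ordAlong, alongSeries_mul, PowerSeries.order_mul]; rfl

/-- `ord (G^n) = n · ord G`. [folklore] -/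
theorem ordAlong_pow (G : MvPolynomial (Fin 5) ℂ) (n : ℕ) : ordAlong (G ^ n) = n • ordAlong G := by
  induction n with
  | zero => simp [ordAlong, alongSeries, ramanujanComposite, dehomog]
  | succ n ih => rw [pow_succ, ordAlong_mul, ih, succ_nsmul]

/-- `ord x₀ = 0`. [folklore] -/
theorem ordAlong_X_zero : ordAlong (X 0 : MvPolynomial (Fin 5) ℂ) = 0 := by
  simp [ordAlong]

/-- `ord x₁ = ord z = 1`. [folklore] -/
theorem ordAlong_X_one : ordAlong (X 1 : MvPolynomial (Fin 5) ℂ) = 1 := by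
  rw [ordAlong, alongSeries_X_one, PowerSeries.order_X]

/-- If `G(ω̂) = 0` then `G(ω̄(z)) = 0` on the unit disc. [folklore] -/
theorem aeval_nesterenkoOmega_eq_zero_of_ordAlong_eq_top {G : MvPolynomial (Fin 5) ℂ}
    (hG : ordAlong G = ⊤) {z : ℂ} (hz : ‖z‖ < 1) : aeval (nesterenkoOmega z) G = 0 :=
  eq_zero_of_hasSum_zero (fun _ hw => hasSum_alongSeries G hw) (PowerSeries.order_eq_top.mp hG) hz

/-- **Asymptotics of `|G(ω̄(z))|`**: if `ord G(ω̂) = v < ∞` then `c|z|^v ≤ |G(ω̄(z))| ≤ C|z|^v`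
near `0`. [folklore] -/
theorem exists_bounds_aeval_nesterenkoOmega {G : MvPolynomial (Fin 5) ℂ} {v : ℕ} (hG : ordAlong G = v) :
    ∃ c C : ℝ, 0 < c ∧ 0 < C ∧ ∀ᶠ z in 𝓝 (0 : ℂ),
      c * ‖z‖ ^ v ≤ ‖aeval (nesterenkoOmega z) G‖ ∧ ‖aeval (nesterenkoOmega z) G‖ ≤ C * ‖z‖ ^ v :=
  exists_bounds_of_hasSum_powerSeries (fun _ hw => hasSum_alongSeries G hw) hG

/-! ### Rational coefficients -/

/-- The formal value of `G ∈ ℚ[x₀, …, x₄]` along `ω̂`. [folklore] -/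
def alongSeriesQ (G : Rx 4) : PowerSeries ℂ :=
  alongSeries (MvPolynomial.map (algebraMap ℚ ℂ) G)

/-- The order of `G ∈ ℚ[x₀, …, x₄]` along `ω̂`. [folklore] -/
def ordAlongQ (G : Rx 4) : ℕ∞ :=
  ordAlong (MvPolynomial.map (algebraMap ℚ ℂ) G)

/-- `ord (GH) = ord G + ord H` (rational coefficients). [folklore] -/
theorem ordAlongQ_mul (G H : Rx 4) : ordAlongQ (G * H) = ordAlongQ G + ordAlongQ H := by
  rw [ordAlongQ, map_mul, ordAlong_mul]; rfl

/-- `ord (Gⁿ) = n · ord G` (rational coefficients). [folklore] -/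
theorem ordAlongQ_pow (G : Rx 4) (n : ℕ) : ordAlongQ (G ^ n) = n • ordAlongQ G := by
  rw [ordAlongQ, map_pow, ordAlong_pow]; rfl

/-- `ord x₀ = 0` (rational coefficients). [folklore] -/
theorem ordAlongQ_X_zero : ordAlongQ (X 0 : Rx 4) = 0 := by
  rw [ordAlongQ, map_X, ordAlong_X_zero]

/-- `ord x₁ = 1` (rational coefficients). [folklore] -/
theorem ordAlongQ_X_one : ordAlongQ (X 1 : Rx 4) = 1 := by
  rw [ordAlongQ, map_X, ordAlong_X_one]

/-- Evaluation of a rational polynomial at the complex point `ω̄(z)` through its complexification.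
[folklore] -/
theorem aeval_map_algebraMap_nesterenkoOmega (G : Rx 4) (z : ℂ) :
    aeval (nesterenkoOmega z) (MvPolynomial.map (algebraMap ℚ ℂ) G) = aeval (nesterenkoOmega z) G := by
  rw [MvPolynomial.aeval_map_algebraMap]

/-- If `G(ω̂) = 0` (`G` rational) then `G(ω̄(z)) = 0` on the unit disc. [folklore] -/
theorem aeval_nesterenkoOmega_eq_zero_of_ordAlongQ_eq_top {G : Rx 4} (hG : ordAlongQ G = ⊤) {z : ℂ}
    (hz : ‖z‖ < 1) : aeval (nesterenkoOmega z) G = 0 := by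
  rw [← aeval_map_algebraMap_nesterenkoOmega]
  exact aeval_nesterenkoOmega_eq_zero_of_ordAlong_eq_top hG hz

/-- **Asymptotics of `|G(ω̄(z))|` for rational `G`** with `ord G(ω̂) = v < ∞`. [folklore] -/
theorem exists_bounds_aeval_nesterenkoOmega_Q {G : Rx 4} {v : ℕ} (hG : ordAlongQ G = v) :
    ∃ c C : ℝ, 0 < c ∧ 0 < C ∧ ∀ᶠ z in 𝓝 (0 : ℂ),
      c * ‖z‖ ^ v ≤ ‖aeval (nesterenkoOmega z) G‖ ∧ ‖aeval (nesterenkoOmega z) G‖ ≤ C * ‖z‖ ^ v := by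
  simpa only [aeval_map_algebraMap_nesterenkoOmega] using exists_bounds_aeval_nesterenkoOmega hG

/-! ### The sup norm of `ω̄(z)` near `z = 0` -/

/-- `ω̄(z) → ω̄(0) = (1, 0, 1, 1, 1)` and `1 ≤ |ω̄(z)| ≤ 2` near `z = 0`. [folklore] -/
theorem eventually_norm_nesterenkoOmega_le_two :
    ∀ᶠ z in 𝓝 (0 : ℂ), 1 ≤ ‖nesterenkoOmega z‖ ∧ ‖nesterenkoOmega z‖ ≤ 2 := by
  -- each coordinate is `G(ω̄(z))` for `G = xᵢ`, continuous at `0` with value of norm `≤ 1`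
  have hcoord : ∀ i : Fin 5, ∀ᶠ z in 𝓝 (0 : ℂ), ‖nesterenkoOmega z i‖ ≤ 2 := by
    intro i
    -- `xᵢ(ω̄(z))` has a power series with constant term of norm ≤ 1: use the asymptotics with
    -- `G = xᵢ − xᵢ(ω̄(0)) x₀`, of positive order, to get `|ωᵢ(z) − ωᵢ(0)| ≤ C|z|^v → 0`.
    have hval : ∀ z, nesterenkoOmega z i = aeval (nesterenkoOmega z) (X i : MvPolynomial (Fin 5) ℂ) :=
      fun z => by rw [aeval_X]
    set G : MvPolynomial (Fin 5) ℂ := X i - C (nesterenkoOmega 0 i) * X 0 with hGdef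
    have hG0 : PowerSeries.constantCoeff (alongSeries G) = 0 := by
      have h := (hasSum_alongSeries G (z := 0) (by simp)).2
      have hval0 : aeval (nesterenkoOmega 0) G = 0 := by
        simp [hGdef, nesterenkoOmega_zero]
      rw [hval0] at h
      have h' : HasSum (fun n => PowerSeries.coeff n (alongSeries G) * (0 : ℂ) ^ n)
          (PowerSeries.coeff 0 (alongSeries G)) := by
        convert hasSum_ite_eq 0 (PowerSeries.coeff 0 (alongSeries G)) using 1
        funext n
        rcases Nat.eq_zero_or_pos n with rfl | hn
        · simp
        · simp [hn.ne']
      rw [← PowerSeries.coeff_zero_eq_constantCoeff_apply]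
      exact h'.unique h
    rcases eq_or_ne (alongSeries G) 0 with hz | hnz
    · -- `G(ω̄(z)) = 0` identically: the coordinate is constant
      filter_upwards [Metric.ball_mem_nhds (0 : ℂ) one_pos] with z hz1
      rw [Metric.mem_ball, dist_zero_right] at hz1
      have h0 : aeval (nesterenkoOmega z) G = 0 :=
        aeval_nesterenkoOmega_eq_zero_of_ordAlong_eq_top (PowerSeries.order_eq_top.mpr hz) hz1
      have : nesterenkoOmega z i = nesterenkoOmega 0 i := by
        have := h0
        simp only [hGdef, map_sub, map_mul, aeval_C, aeval_X, nesterenkoOmega_zero, mul_one,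
          sub_eq_zero] at this
        exact this
      rw [this]
      fin_cases i <;> simp [nesterenkoOmega, (ramanujanPQR_zero).1, (ramanujanPQR_zero).2.1,
        (ramanujanPQR_zero).2.2]
    · obtain ⟨v, hv⟩ : ∃ v : ℕ, ordAlong G = v :=
        ENat.ne_top_iff_exists.mp (by rwa [ordAlong, ne_eq, PowerSeries.order_eq_top])  |>.imp
          fun v hv => hv.symm
      have hv1 : 1 ≤ v := by
        by_contra h
        have hv0 : v = 0 := by omega
        subst hv0
        have := PowerSeries.order_eq_nat.mp hv
        rw [PowerSeries.coeff_zero_eq_constantCoeff, hG0] at this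
        exact this.1 rfl
      obtain ⟨c, Cst, hc, hC, hev⟩ := exists_bounds_aeval_nesterenkoOmega hv
      filter_upwards [hev, Metric.ball_mem_nhds (0 : ℂ) (show (0 : ℝ) < min 1 (1 / Cst) from
        lt_min one_pos (by positivity))] with z hz hz1
      rw [Metric.mem_ball, dist_zero_right, lt_min_iff] at hz1
      have hdiff : ‖nesterenkoOmega z i - nesterenkoOmega 0 i‖ ≤ Cst * ‖z‖ ^ v := by
        have := hz.2
        simpa [hGdef, nesterenkoOmega_zero] using this
      have hsmall : Cst * ‖z‖ ^ v ≤ 1 := by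
        have h1 : ‖z‖ ^ v ≤ ‖z‖ := by
          calc ‖z‖ ^ v ≤ ‖z‖ ^ 1 := pow_le_pow_of_le_one (norm_nonneg _) hz1.1.le hv1
            _ = ‖z‖ := pow_one _
        calc Cst * ‖z‖ ^ v ≤ Cst * ‖z‖ := mul_le_mul_of_nonneg_left h1 hC.le
          _ ≤ Cst * (1 / Cst) := mul_le_mul_of_nonneg_left hz1.2.le hC.le
          _ = 1 := by field_simp
      have h0 : ‖nesterenkoOmega 0 i‖ ≤ 1 := by
        fin_cases i <;> simp [nesterenkoOmega, (ramanujanPQR_zero).1, (ramanujanPQR_zero).2.1,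
          (ramanujanPQR_zero).2.2]
      calc ‖nesterenkoOmega z i‖ ≤ ‖nesterenkoOmega 0 i‖ + ‖nesterenkoOmega z i - nesterenkoOmega 0 i‖ := by
            have := norm_add_le (nesterenkoOmega 0 i) (nesterenkoOmega z i - nesterenkoOmega 0 i)
            rwa [add_sub_cancel] at this
        _ ≤ 1 + 1 := add_le_add h0 (hdiff.trans hsmall)
        _ = 2 := by norm_num
  have hall : ∀ᶠ z in 𝓝 (0 : ℂ), ∀ i, ‖nesterenkoOmega z i‖ ≤ 2 :=
    Filter.eventually_all.mpr hcoord
  filter_upwards [hall] with z hz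
  exact ⟨one_le_norm_nesterenkoOmega z, (pi_norm_le_iff_of_nonneg (by norm_num)).mpr hz⟩


/-! ### The universal `ϰ`: the coefficients of `ϰ_ω̄(F)` are polynomials in `ω̄` -/

section Universal

variable {m : ℕ}

/-- The coefficients of `ϰ_ω̄(F)` are the values at `ω̄` of the (rational) coefficients of the
universal `ϰ(F)`. [folklore] -/
theorem coeff_kappa {r : ℕ} (ω : Fin (m + 1) → ℂ) (F : RU r m) (e : Fin r × SkewIdx m →₀ ℕ) :
    coeff e (kappa ω F) = aeval ω (coeff e (kappaU F)) := by
  rw [← map_kappaU, coeff_map]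
  rfl

/-- Hence the support of `ϰ_ω̄(F)` lies in that of the universal `ϰ(F)`. [folklore] -/
theorem support_kappa_subset {r : ℕ} (ω : Fin (m + 1) → ℂ) (F : RU r m) :
    (kappa ω F).support ⊆ (kappaU F).support := by
  rw [← map_kappaU]
  exact support_map_subset _ _

end Universal

/-! ### The order of an ideal along the curve and the asymptotics of `|I(ω̄(z))|` -/

/-- **`ord I`**: the least order at `z = 0`, along `ω̂`, of the coefficients of the universal `ϰ(F)`,
`F` the associated form of `I` of index `r` (`⊤` if they all vanish along `ω̂`, e.g. if `F = 0`).
This is the `z`-adic valuation `−log |I(ω̄)|` of Ch. 10 §2 for the projectivised variable `z`.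
[cite: NesterenkoPhilippon2001, Ch. 10 §2 (p. 153), Ch. 3 Def. 4.6 (p. 39)] -/
def ordI (I : Ideal (Rx 4)) (r : ℕ) : ℕ∞ :=
  (kappaU (chowForm I r)).support.inf fun e => ordAlongQ (coeff e (kappaU (chowForm I r)))

/-- `ord I ≤ ord` of each coefficient of the universal `ϰ(F)` in its support. [folklore] -/
theorem ordI_le {I : Ideal (Rx 4)} {r : ℕ} {e : Fin r × SkewIdx 4 →₀ ℕ}
    (he : e ∈ (kappaU (chowForm I r)).support) :
    ordI I r ≤ ordAlongQ (coeff e (kappaU (chowForm I r))) :=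
  Finset.inf_le he

/-- If `ord I = ⊤` then `ϰ_{ω̄(z)}(F) = 0`, hence `|I(ω̄(z))| = 0`, on the unit disc. [folklore] -/
theorem iabs_eq_zero_of_ordI_eq_top {I : Ideal (Rx 4)} {r : ℕ} (h : ordI I r = ⊤) {z : ℂ}
    (hz : ‖z‖ < 1) : iabs I r (nesterenkoOmega z) = 0 := by
  have hk : kappa (nesterenkoOmega z) (chowForm I r) = 0 := by
    ext e
    rw [coeff_kappa, coeff_zero]
    by_cases he : e ∈ (kappaU (chowForm I r)).support
    · have htop : ordAlongQ (coeff e (kappaU (chowForm I r))) = ⊤ :=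
        eq_top_iff.mpr (h ▸ ordI_le he)
      exact aeval_nesterenkoOmega_eq_zero_of_ordAlongQ_eq_top htop hz
    · rw [notMem_support_iff.mp he, map_zero]
  rw [iabs, hk, maxNorm_zero, zero_div]

/-- **Asymptotics of `|I(ω̄(z))|`**: if `ord I = V < ∞` then `c|z|^V ≤ |I(ω̄(z))| ≤ C|z|^V` near
`z = 0` for some `c, C > 0`. [folklore] -/
theorem exists_bounds_iabs {I : Ideal (Rx 4)} {r V : ℕ} (hV : ordI I r = V) :
    ∃ c C : ℝ, 0 < c ∧ 0 < C ∧ ∀ᶠ z in 𝓝 (0 : ℂ),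
      c * ‖z‖ ^ V ≤ iabs I r (nesterenkoOmega z) ∧ iabs I r (nesterenkoOmega z) ≤ C * ‖z‖ ^ V := by
  classical
  set F := chowForm I r with hFdef
  set S := (kappaU F).support with hS
  -- the support is non-empty (else `ord I = ⊤`)
  have hSne : S.Nonempty := by
    by_contra hemp
    rw [Finset.not_nonempty_iff_eq_empty] at hemp
    have : ordI I r = ⊤ := by rw [ordI, ← hFdef, ← hS, hemp, Finset.inf_empty]
    rw [hV] at this
    exact ENat.coe_ne_top V this
  -- a coefficient realising the minimum
  obtain ⟨e₀, he₀S, he₀⟩ := Finset.exists_mem_eq_inf S hSne fun e => ordAlongQ (coeff e (kappaU F))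
  have hV₀ : ordAlongQ (coeff e₀ (kappaU F)) = V := by rw [← he₀, ← hV, ordI]
  -- `F ≠ 0`
  have hF0 : F ≠ 0 := by
    intro h0
    have : kappaU F = 0 := by rw [h0, kappaU, map_zero]
    rw [hS, this, support_zero] at he₀S
    simp at he₀S
  have hFpos : 0 < maxNorm F := maxNorm_pos hF0
  -- per-coefficient bounds
  have hcoef : ∀ e ∈ S, ∃ C : ℝ, 0 < C ∧ ∀ᶠ z in 𝓝 (0 : ℂ),
      ‖coeff e (kappa (nesterenkoOmega z) F)‖ ≤ C * ‖z‖ ^ V := by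
    intro e he
    rcases eq_or_ne (ordAlongQ (coeff e (kappaU F))) ⊤ with htop | hne
    · refine ⟨1, one_pos, ?_⟩
      filter_upwards [Metric.ball_mem_nhds (0 : ℂ) one_pos] with z hz
      rw [Metric.mem_ball, dist_zero_right] at hz
      rw [coeff_kappa, aeval_nesterenkoOmega_eq_zero_of_ordAlongQ_eq_top htop hz, norm_zero]
      positivity
    · obtain ⟨v, hv⟩ := ENat.ne_top_iff_exists.mp hne
      have hVv : V ≤ v := by
        have := Finset.inf_le (f := fun e => ordAlongQ (coeff e (kappaU F))) he
        rw [← hv] at this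
        change ordI I r ≤ (v : ℕ∞) at this
        rw [hV] at this
        exact_mod_cast this
      obtain ⟨c, C, -, hC, hev⟩ := exists_bounds_aeval_nesterenkoOmega_Q hv.symm
      refine ⟨C, hC, ?_⟩
      filter_upwards [hev, Metric.ball_mem_nhds (0 : ℂ) one_pos] with z hz hz1
      rw [Metric.mem_ball, dist_zero_right] at hz1
      rw [coeff_kappa]
      refine hz.2.trans (mul_le_mul_of_nonneg_left ?_ hC.le)
      exact pow_le_pow_of_le_one (norm_nonneg _) hz1.le hVv
  choose! Cf hCfpos hCf using hcoef
  set Csum : ℝ := ∑ e ∈ S, Cf e with hCsum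
  have hCle : ∀ e ∈ S, Cf e ≤ Csum := fun e he =>
    Finset.single_le_sum (fun e' he' => (hCfpos e' he').le) he
  have hCsum_pos : 0 < Csum := (hCfpos e₀ he₀S).trans_le (hCle e₀ he₀S)
  have hall : ∀ᶠ z in 𝓝 (0 : ℂ), ∀ e ∈ S, ‖coeff e (kappa (nesterenkoOmega z) F)‖ ≤ Cf e * ‖z‖ ^ V :=
    (Filter.eventually_all_finset S).mpr fun e he => hCf e he
  obtain ⟨c₀, C₀, hc₀, -, hev₀⟩ := exists_bounds_aeval_nesterenkoOmega_Q hV₀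
  -- assemble
  refine ⟨c₀ / (maxNorm F * 2 ^ (r * ideg I r)), Csum / maxNorm F, by positivity, by positivity, ?_⟩
  filter_upwards [hall, hev₀, eventually_norm_nesterenkoOmega_le_two] with z hz hz₀ hω
  have hωpos : 0 < ‖nesterenkoOmega z‖ := one_pos.trans_le hω.1
  have hden : 0 < maxNorm F * ‖nesterenkoOmega z‖ ^ (r * ideg I r) := mul_pos hFpos (pow_pos hωpos _)
  have hup : maxNorm (kappa (nesterenkoOmega z) F) ≤ Csum * ‖z‖ ^ V := by
    refine maxNorm_le_of_forall_le (by positivity) fun γ hγ => ?_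
    have hγS : γ ∈ S := support_kappa_subset _ _ hγ
    exact (hz γ hγS).trans (mul_le_mul_of_nonneg_right (hCle γ hγS) (by positivity))
  have hlow : c₀ * ‖z‖ ^ V ≤ maxNorm (kappa (nesterenkoOmega z) F) := by
    refine hz₀.1.trans ?_
    rw [← coeff_kappa]
    exact norm_coeff_le_maxNorm _ _
  rw [iabs, ← hFdef]
  constructor
  · rw [le_div_iff₀ hden]
    calc c₀ / (maxNorm F * 2 ^ (r * ideg I r)) * ‖z‖ ^ V * (maxNorm F * ‖nesterenkoOmega z‖ ^ (r * ideg I r))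
        = c₀ * ‖z‖ ^ V * (‖nesterenkoOmega z‖ ^ (r * ideg I r) / 2 ^ (r * ideg I r)) := by
          field_simp
      _ ≤ c₀ * ‖z‖ ^ V * 1 := by
          refine mul_le_mul_of_nonneg_left ?_ (by positivity)
          rw [div_le_one (by positivity)]
          exact pow_le_pow_left₀ hωpos.le hω.2 _
      _ ≤ maxNorm (kappa (nesterenkoOmega z) F) := by rw [mul_one]; exact hlow
  · rw [div_le_iff₀ hden]
    calc maxNorm (kappa (nesterenkoOmega z) F) ≤ Csum * ‖z‖ ^ V := hup
      _ = Csum / maxNorm F * ‖z‖ ^ V * (maxNorm F * 1) := by field_simp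
      _ ≤ Csum / maxNorm F * ‖z‖ ^ V * (maxNorm F * ‖nesterenkoOmega z‖ ^ (r * ideg I r)) := by
          refine mul_le_mul_of_nonneg_left (mul_le_mul_of_nonneg_left ?_ hFpos.le) (by positivity)
          exact one_le_pow₀ hω.1

/-! ### Asymptotics of `‖P‖_{ω̄(z)}` -/

/-- If `P(ω̂) = 0` then `‖P‖_{ω̄(z)} = 0` on the unit disc. [folklore] -/
theorem normAt_eq_zero_of_ordAlongQ_eq_top {P : Rx 4} (h : ordAlongQ P = ⊤) {z : ℂ} (hz : ‖z‖ < 1) :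
    normAt (nesterenkoOmega z) P = 0 := by
  rw [normAt, aeval_nesterenkoOmega_eq_zero_of_ordAlongQ_eq_top h hz, norm_zero, zero_div]

/-- **Asymptotics of `‖P‖_{ω̄(z)}`**: if `ord P(ω̂) = v < ∞` then `c|z|^v ≤ ‖P‖_{ω̄(z)} ≤ C|z|^v`
near `z = 0` for some `c, C > 0`. [folklore] -/
theorem exists_bounds_normAt {P : Rx 4} {v : ℕ} (hv : ordAlongQ P = v) :
    ∃ c C : ℝ, 0 < c ∧ 0 < C ∧ ∀ᶠ z in 𝓝 (0 : ℂ),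
      c * ‖z‖ ^ v ≤ normAt (nesterenkoOmega z) P ∧ normAt (nesterenkoOmega z) P ≤ C * ‖z‖ ^ v := by
  have hP0 : P ≠ 0 := by
    rintro rfl
    rw [ordAlongQ, map_zero, ordAlong, alongSeries_zero, PowerSeries.order_zero] at hv
    exact ENat.top_ne_coe v hv
  have hPpos : 0 < maxNorm P := maxNorm_pos hP0
  obtain ⟨c₀, C₀, hc₀, hC₀, hev⟩ := exists_bounds_aeval_nesterenkoOmega_Q hv
  refine ⟨c₀ / (maxNorm P * 2 ^ P.totalDegree), C₀ / maxNorm P, by positivity, by positivity, ?_⟩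
  filter_upwards [hev, eventually_norm_nesterenkoOmega_le_two] with z hz hω
  have hωpos : 0 < ‖nesterenkoOmega z‖ := one_pos.trans_le hω.1
  have hden : 0 < maxNorm P * ‖nesterenkoOmega z‖ ^ P.totalDegree := mul_pos hPpos (pow_pos hωpos _)
  rw [normAt]
  constructor
  · rw [le_div_iff₀ hden]
    calc c₀ / (maxNorm P * 2 ^ P.totalDegree) * ‖z‖ ^ v * (maxNorm P * ‖nesterenkoOmega z‖ ^ P.totalDegree)
        = c₀ * ‖z‖ ^ v * (‖nesterenkoOmega z‖ ^ P.totalDegree / 2 ^ P.totalDegree) := by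
          field_simp
      _ ≤ c₀ * ‖z‖ ^ v * 1 := by
          refine mul_le_mul_of_nonneg_left ?_ (by positivity)
          rw [div_le_one (by positivity)]
          exact pow_le_pow_left₀ hωpos.le hω.2 _
      _ ≤ ‖aeval (nesterenkoOmega z) P‖ := by rw [mul_one]; exact hz.1
  · rw [div_le_iff₀ hden]
    calc ‖aeval (nesterenkoOmega z) P‖ ≤ C₀ * ‖z‖ ^ v := hz.2
      _ = C₀ / maxNorm P * ‖z‖ ^ v * (maxNorm P * 1) := by field_simp
      _ ≤ C₀ / maxNorm P * ‖z‖ ^ v * (maxNorm P * ‖nesterenkoOmega z‖ ^ P.totalDegree) := by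
          refine mul_le_mul_of_nonneg_left (mul_le_mul_of_nonneg_left ?_ hPpos.le) (by positivity)
          exact one_le_pow₀ hω.1

end Transfer

end Literature.Barriers.Schanuel

end
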